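import Literature.NumberTheory.ModularForms.Gamma0FreeModNegOne
import Literature.GroupTheory.SpecificGroups.ModularGroupFreeProduct
import Literature.GroupTheory.CombinatorialGroupTheory.AmalgamTorsionFreeSubgroups
import Literature.GroupTheory.CombinatorialGroupTheory.FiniteAmalgamTorsionConjugacy
import HarnessLib

/-!
# PROOF of `gamma0_eq_negOne_prod_free_of_nine_dvd`: for `9 ∣ M`, `Γ₀(M) = {±1} × (free group)`

(module docstring to be completed)
-/

noncomputable section

open scoped MatrixGroups
open CongruenceSubgroup Monoid
open Literature.GroupTheory.SpecificGroups.ModularGroupFreeProduct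
open Literature.GroupTheory.CombinatorialGroupTheory

namespace Literature.NumberTheory.ModularForms

namespace Gamma0Free

/-! ### §1  The kernel of `SL₂(ℤ) → ℤ/2 ∗ ℤ/3` is `{±1}` -/

/-- An element of `SL₂(ℤ)` fixing every point of `ℍ` has lower-left entry `0`
(`|c i + d|² = 1 = |2c i + d|²`). [folklore] -/
private theorem apply_one_zero_eq_zero_of_forall_smul_eq {g : SL(2, ℤ)} (h : ∀ z : UpperHalfPlane, g • z = z) :
    g 1 0 = 0 := by
  have hnorm : ∀ z : UpperHalfPlane, Complex.normSq (UpperHalfPlane.denom (g : GL (Fin 2) ℝ) z) = 1 := by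
    intro z
    have him := ModularGroup.im_smul_eq_div_normSq g z
    rw [h z] at him
    have hpos : 0 < Complex.normSq (UpperHalfPlane.denom (g : GL (Fin 2) ℝ) z) :=
      Complex.normSq_pos.mpr (UpperHalfPlane.denom_ne_zero _ z)
    have him' := him
    rw [eq_div_iff hpos.ne'] at him'
    -- `z.im * n = z.im`
    have hz : z.im ≠ 0 := z.im_pos.ne'
    have : z.im * Complex.normSq (UpperHalfPlane.denom (g : GL (Fin 2) ℝ) z) = z.im * 1 := by
      rw [mul_one]; exact him'
    exact mul_left_cancel₀ hz this
  have h1 := hnorm UpperHalfPlane.I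
  have h2 := hnorm ⟨2 * Complex.I, by simp⟩
  rw [ModularGroup.denom_apply, Complex.normSq_apply] at h1 h2
  simp only [UpperHalfPlane.coe_I, Complex.add_re, Complex.mul_re,
    Complex.I_re, Complex.I_im, Complex.add_im, Complex.mul_im, Complex.intCast_re, Complex.intCast_im,
    Complex.re_ofNat, Complex.im_ofNat] at h1 h2
  have hc : ((g 1 0 : ℤ) : ℝ) = 0 := by nlinarith
  exact_mod_cast hc

/-- `S g S⁻¹ = (d, −c; −b, a)`: lower-left entry `−b`. [folklore] -/
private theorem S_mul_mul_S_inv_apply_one_zero (g : SL(2, ℤ)) :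
    (ModularGroup.S * g * ModularGroup.S⁻¹) 1 0 = -g 0 1 := by
  have hS : ((ModularGroup.S : SL(2, ℤ)) : Matrix (Fin 2) (Fin 2) ℤ) = !![0, -1; 1, 0] := rfl
  have hSi : ((ModularGroup.S⁻¹ : SL(2, ℤ)) : Matrix (Fin 2) (Fin 2) ℤ) = !![0, 1; -1, 0] := by
    rw [Matrix.SpecialLinearGroup.coe_inv, hS, Matrix.adjugate_fin_two_of]
    simp
  show (((ModularGroup.S : SL(2, ℤ)) : Matrix (Fin 2) (Fin 2) ℤ) * (g : Matrix (Fin 2) (Fin 2) ℤ) *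
      ((ModularGroup.S⁻¹ : SL(2, ℤ)) : Matrix (Fin 2) (Fin 2) ℤ)) 1 0 = -g 0 1
  rw [hS, hSi]
  simp [Matrix.mul_apply, Fin.sum_univ_two, Matrix.vecMul, dotProduct]

/-- **The kernel of the action of `SL₂(ℤ)` on `ℍ` is `{±1}`** ("`G = SL₂(ℤ)/{±1}` opère sur `H`", faithfully:
an element fixing every point of `ℍ` is `±1`). [cite: Serre1973, Ch. VII §1.1] -/
theorem eq_one_or_eq_neg_one_of_forall_smul_eq {g : SL(2, ℤ)} (h : ∀ z : UpperHalfPlane, g • z = z) :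
    g = 1 ∨ g = -1 := by
  have hc : g 1 0 = 0 := apply_one_zero_eq_zero_of_forall_smul_eq h
  have hconj : ∀ z : UpperHalfPlane, (ModularGroup.S * g * ModularGroup.S⁻¹) • z = z := by
    intro z
    rw [mul_smul, mul_smul, h, ← mul_smul, mul_inv_cancel, one_smul]
  have hb : g 0 1 = 0 := by
    have := apply_one_zero_eq_zero_of_forall_smul_eq hconj
    rw [S_mul_mul_S_inv_apply_one_zero] at this
    exact neg_eq_zero.mp this
  have hdet : g 0 0 * g 1 1 = 1 := by
    have := Matrix.det_fin_two (g : Matrix (Fin 2) (Fin 2) ℤ)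
    rw [g.det_coe, hb, hc] at this
    linear_combination -this
  rcases Int.eq_one_or_neg_one_of_mul_eq_one' hdet with ⟨ha, hd⟩ | ⟨ha, hd⟩
  · left
    ext i j
    fin_cases i <;> fin_cases j <;> simp [ha, hb, hc, hd]
  · right
    ext i j
    fin_cases i <;> fin_cases j <;> simp [ha, hb, hc, hd]

/-- **`ker (SL₂(ℤ) → ℤ/2 ∗ ℤ/3) = {±1}`**: `fromSL g = 1` iff `g` acts trivially on `ℍ`
(`ModularGroupFreeProduct.fromSL_eq_one_iff`) iff `g = ±1`. [cite: SerreTrees1980, I.4.2] -/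
theorem eq_one_or_eq_neg_one_of_fromSL_eq_one {g : SL(2, ℤ)} (h : fromSL g = 1) : g = 1 ∨ g = -1 :=
  eq_one_or_eq_neg_one_of_forall_smul_eq ((fromSL_eq_one_iff g).mp h)

/-! ### §2  `ℤ/2 ∗ ℤ/3` as an amalgam over the trivial group

The tree's free-subgroup and torsion theorems are stated for Mathlib's amalgamated product `PushoutI φ`;
`ℤ/2 ∗ ℤ/3 = CoprodI Fac` is `PushoutI φ` for the (necessarily trivial) gluing maps `φ b : PUnit →* Fac b`,
via `PushoutI.ofCoprodI`.  We keep `φ` as a variable (no new definitions in this file). -/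

section Amalgam

variable (φ : ∀ b : Bool, PUnit.{1} →* Fac b)

/-- Maps out of the one-element group are injective. [folklore] -/
private theorem trivMaps_injective (b : Bool) : Function.Injective (φ b) :=
  fun x y _ => Subsingleton.elim x y

/-- `ofCoprodI (of g) = of g`. [folklore] -/
private theorem ofCoprodI_of' (b : Bool) (g : Fac b) :
    (PushoutI.ofCoprodI (CoprodI.of g) : PushoutI φ) = PushoutI.of (φ := φ) b g := by
  simp

/-- `ℤ/2 ∗ ℤ/3 → PushoutI φ` has a two-sided inverse (the amalgam over the trivial group IS the free product).
[folklore] -/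
private theorem exists_inverse_ofCoprodI :
    ∃ f : PushoutI φ →* FP, f.comp (PushoutI.ofCoprodI (φ := φ)) = MonoidHom.id FP ∧
      (PushoutI.ofCoprodI (φ := φ)).comp f = MonoidHom.id (PushoutI φ) := by
  let f : PushoutI φ →* FP :=
    PushoutI.lift (fun b => (CoprodI.of : Fac b →* FP)) 1 fun b => by
      ext x
      rw [show x = 1 from Subsingleton.elim x 1, map_one, map_one]
  have hf : ∀ (b : Bool) (g : Fac b), f (PushoutI.of (φ := φ) b g) = CoprodI.of g := fun b g => by
    simp [f]
  refine ⟨f, ?_, ?_⟩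
  · refine CoprodI.ext_hom _ _ fun b => ?_
    ext g
    simp [hf]
  · refine PushoutI.hom_ext (fun b => ?_) ?_
    · ext g
      simp [hf]
    · ext x
      rw [show x = 1 from Subsingleton.elim x 1, map_one, map_one]

/-- `ℤ/2 ∗ ℤ/3 → PushoutI φ` is injective. [folklore] -/
private theorem ofCoprodI_injective : Function.Injective (PushoutI.ofCoprodI (φ := φ) : FP → PushoutI φ) := by
  obtain ⟨f, hf, -⟩ := exists_inverse_ofCoprodI φ
  intro x y h
  have := congrArg f h
  rwa [← MonoidHom.comp_apply, ← MonoidHom.comp_apply, hf] at this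

/-- `ℤ/2 ∗ ℤ/3 → PushoutI φ` is surjective. [folklore] -/
private theorem ofCoprodI_surjective : Function.Surjective (PushoutI.ofCoprodI (φ := φ) : FP → PushoutI φ) := by
  obtain ⟨f, -, hf⟩ := exists_inverse_ofCoprodI φ
  intro p
  exact ⟨f p, by rw [← MonoidHom.comp_apply, hf, MonoidHom.id_apply]⟩

/-- `π : SL₂(ℤ) → ℤ/2 ∗ ℤ/3 → PushoutI φ` is surjective. [folklore] -/
private theorem proj_surjective :
    Function.Surjective ((PushoutI.ofCoprodI (φ := φ)).comp fromSL : SL(2, ℤ) → PushoutI φ) :=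
  (ofCoprodI_surjective φ).comp fromSL_surjective

/-- `π g = 1 ⟹ g = ±1`. [folklore] -/
private theorem eq_one_or_eq_neg_one_of_proj_eq_one {g : SL(2, ℤ)}
    (h : (PushoutI.ofCoprodI (φ := φ)).comp fromSL g = 1) : g = 1 ∨ g = -1 :=
  eq_one_or_eq_neg_one_of_fromSL_eq_one (ofCoprodI_injective φ (by rw [map_one]; exact h))

/-- `π (-1) = 1`. [folklore] -/
private theorem proj_neg_one : (PushoutI.ofCoprodI (φ := φ)).comp fromSL (-1) = 1 := by
  simp

/-- `π S = of genS`. [folklore] -/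
private theorem proj_S : (PushoutI.ofCoprodI (φ := φ)).comp fromSL ModularGroup.S = PushoutI.of (φ := φ) true genS := by
  simp [inS_def]

/-- `π U = of genU`. [folklore] -/
private theorem proj_U : (PushoutI.ofCoprodI (φ := φ)).comp fromSL U = PushoutI.of (φ := φ) false genU := by
  simp [inU_def]

end Amalgam

/-! ### §3  `Γ₀(M)`, `9 ∣ M`, has no elliptic elements -/

/-- The trace is a class function on `SL₂(ℤ)`: `tr(δ γ δ⁻¹) = tr γ`. [folklore] -/
private theorem trace_conj (δ γ : SL(2, ℤ)) :
    (δ * γ * δ⁻¹) 0 0 + (δ * γ * δ⁻¹) 1 1 = γ 0 0 + γ 1 1 := by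
  have h1 : ((δ * γ * δ⁻¹ : SL(2, ℤ)) : Matrix (Fin 2) (Fin 2) ℤ).trace = (γ : Matrix (Fin 2) (Fin 2) ℤ).trace := by
    rw [Matrix.SpecialLinearGroup.coe_mul, Matrix.SpecialLinearGroup.coe_mul, Matrix.SpecialLinearGroup.coe_inv,
      Matrix.trace_mul_cycle, Matrix.adjugate_mul, δ.det_coe, one_smul, one_mul]
  rw [Matrix.trace_fin_two, Matrix.trace_fin_two] at h1
  exact h1

/-- Trace of `-γ`. [folklore] -/
private theorem trace_neg (γ : SL(2, ℤ)) : (-γ) 0 0 + (-γ) 1 1 = -(γ 0 0 + γ 1 1) := by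
  rw [show (-γ) 0 0 = -(γ 0 0) from rfl, show (-γ) 1 1 = -(γ 1 1) from rfl]; ring

/-- In `ℤ/9`: `a d = 1` forces `a + d ∉ {0, 1, −1}` (`x² + 1`, `x² ± x + 1` have no roots with `x` a unit
mod `9`; finite check). [cite: DiamondShurman2005, Cor. 3.7.2] -/
theorem zmod_nine_trace {a d : ZMod 9} (h : a * d = 1) : a + d ≠ 0 ∧ a + d ≠ 1 ∧ a + d ≠ -1 := by
  revert a d
  decide

/-- **No elliptic elements in `Γ₀(M)` for `9 ∣ M`**: the trace of `γ ∈ Γ₀(M)` is never `0`, `1` or `−1`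
(`ε₂(Γ₀(M)) = ε₃(Γ₀(M)) = 0`: `a d ≡ 1 (mod 9)` since `9 ∣ c`). [cite: DiamondShurman2005, Cor. 3.7.2] -/
theorem trace_ne_of_nine_dvd {M : ℕ} (h9 : 9 ∣ M) {γ : SL(2, ℤ)} (hγ : γ ∈ Gamma0 M) :
    γ 0 0 + γ 1 1 ≠ 0 ∧ γ 0 0 + γ 1 1 ≠ 1 ∧ γ 0 0 + γ 1 1 ≠ -1 := by
  have hc : (9 : ℤ) ∣ γ 1 0 := by
    rw [Gamma0_mem] at hγ
    exact dvd_trans (by exact_mod_cast h9) ((ZMod.intCast_zmod_eq_zero_iff_dvd _ _).mp hγ)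
  have hdet : γ 0 0 * γ 1 1 - γ 0 1 * γ 1 0 = 1 := by
    have := Matrix.det_fin_two (γ : Matrix (Fin 2) (Fin 2) ℤ)
    rw [γ.det_coe] at this
    exact this.symm
  have hmod : ((γ 0 0 : ℤ) : ZMod 9) * ((γ 1 1 : ℤ) : ZMod 9) = 1 := by
    have hc0 : ((γ 1 0 : ℤ) : ZMod 9) = 0 := (ZMod.intCast_zmod_eq_zero_iff_dvd _ 9).mpr (by exact_mod_cast hc)
    have := congrArg (Int.cast : ℤ → ZMod 9) hdet
    push_cast at this
    rw [hc0, mul_zero, sub_zero] at this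
    exact this
  obtain ⟨h0, h1, h2⟩ := zmod_nine_trace hmod
  refine ⟨fun h => h0 ?_, fun h => h1 ?_, fun h => h2 ?_⟩
  · exact_mod_cast congrArg (Int.cast : ℤ → ZMod 9) h
  · exact_mod_cast congrArg (Int.cast : ℤ → ZMod 9) h
  · exact_mod_cast congrArg (Int.cast : ℤ → ZMod 9) h

section Torsion

variable (φ : ∀ b : Bool, PUnit.{1} →* Fac b)

/-- The elliptic generators `S`, `U`, `U²` of `SL₂(ℤ)` have trace `0`, `1`, `−1`, and their images in
`PushoutI φ` are the non-trivial elements of the two factors. [cite: SerreTrees1980, I.4.2] -/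
theorem exists_elliptic_of_ne_one (i : Bool) (g : Fac i) (hg : g ≠ 1) :
    ∃ x : SL(2, ℤ), (PushoutI.ofCoprodI (φ := φ)).comp fromSL x = PushoutI.of (φ := φ) i g ∧
      (x 0 0 + x 1 1 = 0 ∨ x 0 0 + x 1 1 = 1 ∨ x 0 0 + x 1 1 = -1) := by
  cases i
  · obtain ⟨n, hn, rfl⟩ := exists_genU_pow g
    interval_cases n
    · exact absurd (pow_zero _) hg
    · exact ⟨U, by rw [pow_one, proj_U], Or.inr (Or.inl (by decide))⟩
    · exact ⟨U ^ 2, by rw [map_pow, proj_U, map_pow], Or.inr (Or.inr (by decide))⟩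
  · obtain ⟨n, hn, rfl⟩ := exists_genS_pow g
    interval_cases n
    · exact absurd (pow_zero _) hg
    · exact ⟨ModularGroup.S, by rw [pow_one, proj_S], Or.inl (by decide)⟩

/-- **The image of `Γ₀(M)` in `ℤ/2 ∗ ℤ/3` is torsion-free for `9 ∣ M`.**  An element of finite order of
the amalgam is conjugate into a factor (`Amalgam.exists_conj_eq_of_of_isOfFinOrder`); pulling the conjugator
back to `SL₂(ℤ)` (`π` is onto with kernel `±1`), a non-trivial one would make a conjugate of `γ ∈ Γ₀(M)`
equal to `±S`, `±U` or `±U²`, of trace `0, ±1` — excluded by `trace_ne_of_nine_dvd`.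
[cite: Kulkarni1991, Thm. 3.2 and Thm. 3.3] -/
theorem proj_eq_one_of_isOfFinOrder {M : ℕ} (h9 : 9 ∣ M) {k : PushoutI φ}
    (hk : k ∈ (Gamma0 M).map ((PushoutI.ofCoprodI (φ := φ)).comp fromSL)) (hfin : IsOfFinOrder k) :
    k = 1 := by
  haveI : Nonempty Bool := ⟨true⟩
  obtain ⟨γ, hγ, rfl⟩ := hk
  obtain ⟨p, i, g, hp⟩ := Amalgam.exists_conj_eq_of_of_isOfFinOrder (trivMaps_injective φ) hfin
  obtain ⟨δ, rfl⟩ := proj_surjective φ p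
  by_cases hg : g = 1
  · rw [hg, map_one] at hp
    have := congrArg (fun y => ((PushoutI.ofCoprodI (φ := φ)).comp fromSL δ)⁻¹ * y *
      (PushoutI.ofCoprodI (φ := φ)).comp fromSL δ) hp
    simpa [mul_assoc] using this
  · exfalso
    obtain ⟨x, hx, htr⟩ := exists_elliptic_of_ne_one φ i g hg
    rw [← hx, ← map_mul, ← map_inv, ← map_mul] at hp
    have h1 : (PushoutI.ofCoprodI (φ := φ)).comp fromSL (δ * γ * δ⁻¹ * x⁻¹) = 1 := by
      rw [map_mul, hp, map_inv, mul_inv_cancel]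
    have htrγ := trace_ne_of_nine_dvd h9 (γ := γ) hγ
    rw [← trace_conj δ γ] at htrγ
    rcases eq_one_or_eq_neg_one_of_proj_eq_one φ h1 with h | h
    · rw [mul_inv_eq_one] at h
      rw [h] at htrγ
      tauto
    · rw [mul_inv_eq_iff_eq_mul, neg_one_mul] at h
      rw [h, trace_neg] at htrγ
      rcases htr with e | e | e <;> simp [e] at htrγ

end Torsion

/-! ### §4  The theorem -/

/-- `-1 ≠ 1` in `SL₂(ℤ)`. [folklore] -/
private theorem neg_one_ne_one : (-1 : SL(2, ℤ)) ≠ 1 := by decide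

end Gamma0Free

open Gamma0Free in
/-- **Kulkarni's theorem for `Γ₀(M)`, `9 ∣ M` — PROVED**: `Γ₀(M) = {±1} × e(F)` with `F` free and the
decomposition `γ = ± e(w)` unique.  Proof: `PSL₂(ℤ) ≅ ℤ/2 ∗ ℤ/3` (tree: `ModularGroupFreeProduct`, ping-pong on
`ℍ`), the image of `Γ₀(M)` is torsion-free (`proj_eq_one_of_isOfFinOrder`: no elliptic elements when `9 ∣ M`), a
torsion-free subgroup of an amalgam of finite groups is free (tree: `isFreeGroup_of_finite_factors`, Bass–Serre
/ Kurosh), and a free basis lifts along `Γ₀(M) ↠ image` (kernel `{±1}`).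
[cite: Kulkarni1991, Thm. 3.2 and Thm. 3.3] [cite: DiamondShurman2005, Cor. 3.7.2] -/
theorem gamma0_eq_negOne_prod_free_of_nine_dvd_holds : gamma0_eq_negOne_prod_free_of_nine_dvd := by
  intro M h9
  haveI : Nonempty Bool := ⟨true⟩
  let φ : ∀ b : Bool, PUnit.{1} →* Fac b := fun _ => 1
  let proj : SL(2, ℤ) →* PushoutI φ := (PushoutI.ofCoprodI (φ := φ)).comp fromSL
  let K : Subgroup (PushoutI φ) := (Gamma0 M).map proj
  haveI hK : IsFreeGroup K :=
    isFreeGroup_of_finite_factors (trivMaps_injective φ) K fun k hk hfin =>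
      proj_eq_one_of_isOfFinOrder φ h9 hk hfin
  -- `π` restricted to `Γ₀(M) ↠ K`
  let πK : Gamma0 M →* K := (proj.comp (Gamma0 M).subtype).codRestrict K fun γ => ⟨γ, γ.2, rfl⟩
  have hπK : ∀ γ : Gamma0 M, ((πK γ : K) : PushoutI φ) = proj (γ : SL(2, ℤ)) := fun γ => rfl
  have hπK_surj : Function.Surjective πK := by
    rintro ⟨_, γ, hγ, rfl⟩
    exact ⟨⟨γ, hγ⟩, rfl⟩
  -- a free basis of `K` and a section over it
  choose sec hsec using fun x : IsFreeGroup.Generators K => hπK_surj (IsFreeGroup.of x)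
  let e₀ : FreeGroup (IsFreeGroup.Generators K) →* Gamma0 M := FreeGroup.lift sec
  let e : FreeGroup (IsFreeGroup.Generators K) →* SL(2, ℤ) := (Gamma0 M).subtype.comp e₀
  have he : ∀ w, e w = ((e₀ w : Gamma0 M) : SL(2, ℤ)) := fun w => rfl
  have hcomp : πK.comp e₀ = (IsFreeGroup.mulEquiv K).toMonoidHom := by
    refine FreeGroup.ext_hom _ _ fun x => ?_
    rw [MonoidHom.comp_apply, MulEquiv.coe_toMonoidHom]
    show πK (FreeGroup.lift sec (FreeGroup.of x)) = _
    rw [FreeGroup.lift_apply_of, hsec]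
    rfl
  have hcomp' : ∀ w, πK (e₀ w) = IsFreeGroup.mulEquiv K w := fun w => by
    rw [← MonoidHom.comp_apply, hcomp]; rfl
  refine ⟨IsFreeGroup.Generators K, e, fun w => (e₀ w).2, fun γ hγ => ?_⟩
  -- existence
  let w := (IsFreeGroup.mulEquiv K).symm (πK ⟨γ, hγ⟩)
  have hw : proj (e w) = proj γ := by
    rw [he, ← hπK, hcomp', MulEquiv.apply_symm_apply]
    exact hπK ⟨γ, hγ⟩
  have h1 : proj (γ * (e w)⁻¹) = 1 := by rw [map_mul, map_inv, hw, mul_inv_cancel]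
  have hex : ∃ s : Bool, γ = (if s then (-1 : SL(2, ℤ)) else 1) * e w := by
    rcases eq_one_or_eq_neg_one_of_proj_eq_one φ h1 with h | h
    · exact ⟨false, by rw [mul_inv_eq_one] at h; simpa using h⟩
    · exact ⟨true, by rw [mul_inv_eq_iff_eq_mul] at h; simpa using h⟩
  obtain ⟨s, hs⟩ := hex
  refine ⟨(w, s), hs, ?_⟩
  -- uniqueness
  rintro ⟨w', s'⟩ hs'
  have hww : w' = w := by
    have h2 : proj (e w') = proj (e w) := by
      have a1 := congrArg proj hs
      have a2 := congrArg proj hs'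
      rw [map_mul] at a1 a2
      have hsgn : ∀ b : Bool, proj (if b then (-1 : SL(2, ℤ)) else 1) = 1 := by
        intro b; cases b
        · simp
        · simp only [if_true]; exact proj_neg_one φ
      rw [hsgn, one_mul] at a1 a2
      rw [← a2, ← a1]
    have h3 : πK (e₀ w') = πK (e₀ w) := Subtype.ext (by rw [hπK, hπK, ← he, ← he, h2])
    rw [hcomp', hcomp'] at h3
    exact (IsFreeGroup.mulEquiv K).injective h3
  subst hww
  have hss : (if s' then (-1 : SL(2, ℤ)) else 1) = (if s then (-1 : SL(2, ℤ)) else 1) :=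
    mul_right_cancel (hs'.symm.trans hs)
  have : s' = s := by
    cases s <;> cases s'
    · rfl
    · exfalso
      rw [if_pos rfl, if_neg Bool.false_ne_true] at hss
      exact neg_one_ne_one hss
    · exfalso
      rw [if_pos rfl, if_neg Bool.false_ne_true] at hss
      exact neg_one_ne_one hss.symm
    · rfl
  rw [this]

/-! ### §5  (appended) The general form: no elliptic elements ⟹ `Γ₀(M) = {±1} × free`; the cases `4 ∣ M`, `6 ∣ M`

The argument of §3–§4 uses `9 ∣ M` only through `trace_ne_of_nine_dvd`.  This appendix records the statement for every
level `M` at which `Γ₀(M)` has NO ELLIPTIC ELEMENTS (no element of trace `0` or `±1`), i.e. `ε₂(Γ₀(M)) = ε₃(Γ₀(M)) = 0`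
[Diamond–Shurman Cor. 3.7.2: `ε₂ = 0` iff `4 ∣ M` or some prime `≡ 3 (mod 4)` divides `M`; `ε₃ = 0` iff `9 ∣ M` or some
prime `≡ 2 (mod 3)` divides `M`], and the two further instances `4 ∣ M` (the `p = 2` twin of the cell's E-es-108: the
factor `1 + (−3/2) = 0` kills `ε₃`) and `6 ∣ M` (`1 + (−1/3) = 0`, `1 + (−3/2) = 0`), by the same finite trace check in
`ℤ/4`, `ℤ/6`.  (`-- TODO(general form)` of the statement file, torsion-free case.) -/

namespace Gamma0Free

section General

variable (φ : ∀ b : Bool, PUnit.{1} →* Fac b)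

/-- The image of `Γ₀(M)` in `ℤ/2 ∗ ℤ/3` is torsion-free as soon as `Γ₀(M)` has no element of trace `0, ±1`
(no elliptic elements). [cite: Kulkarni1991, Thm. 3.2 and Thm. 3.3] -/
private theorem proj_eq_one_of_isOfFinOrder_of_trace_ne {M : ℕ}
    (htr : ∀ γ : SL(2, ℤ), γ ∈ Gamma0 M → γ 0 0 + γ 1 1 ≠ 0 ∧ γ 0 0 + γ 1 1 ≠ 1 ∧ γ 0 0 + γ 1 1 ≠ -1)
    {k : PushoutI φ} (hk : k ∈ (Gamma0 M).map ((PushoutI.ofCoprodI (φ := φ)).comp fromSL))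
    (hfin : IsOfFinOrder k) : k = 1 := by
  haveI : Nonempty Bool := ⟨true⟩
  obtain ⟨γ, hγ, rfl⟩ := hk
  obtain ⟨p, i, g, hp⟩ := Amalgam.exists_conj_eq_of_of_isOfFinOrder (trivMaps_injective φ) hfin
  obtain ⟨δ, rfl⟩ := proj_surjective φ p
  by_cases hg : g = 1
  · rw [hg, map_one] at hp
    have := congrArg (fun y => ((PushoutI.ofCoprodI (φ := φ)).comp fromSL δ)⁻¹ * y *
      (PushoutI.ofCoprodI (φ := φ)).comp fromSL δ) hp
    simpa [mul_assoc] using this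
  · exfalso
    obtain ⟨x, hx, htrx⟩ := exists_elliptic_of_ne_one φ i g hg
    rw [← hx, ← map_mul, ← map_inv, ← map_mul] at hp
    have h1 : (PushoutI.ofCoprodI (φ := φ)).comp fromSL (δ * γ * δ⁻¹ * x⁻¹) = 1 := by
      rw [map_mul, hp, map_inv, mul_inv_cancel]
    have htrγ := htr γ hγ
    rw [← trace_conj δ γ] at htrγ
    rcases eq_one_or_eq_neg_one_of_proj_eq_one φ h1 with h | h
    · rw [mul_inv_eq_one] at h
      rw [h] at htrγ
      tauto
    · rw [mul_inv_eq_iff_eq_mul, neg_one_mul] at h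
      rw [h, trace_neg] at htrγ
      rcases htrx with e | e | e <;> simp [e] at htrγ

end General

/-- In `ℤ/4`: `a d = 1` forces `a + d = 2`, in particular `a + d ∉ {0, 1, −1}`. [cite: DiamondShurman2005, Cor. 3.7.2] -/
private theorem zmod_four_trace {a d : ZMod 4} (h : a * d = 1) : a + d ≠ 0 ∧ a + d ≠ 1 ∧ a + d ≠ -1 := by
  revert a d
  decide

/-- In `ℤ/6`: `a d = 1` forces `a + d ∈ {2, 4}`, in particular `a + d ∉ {0, 1, −1}`. [cite: DiamondShurman2005, Cor. 3.7.2] -/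
private theorem zmod_six_trace {a d : ZMod 6} (h : a * d = 1) : a + d ≠ 0 ∧ a + d ≠ 1 ∧ a + d ≠ -1 := by
  revert a d
  decide

/-- From `n ∣ c` and `a d − b c = 1`: `a d = 1` in `ℤ/n`, and an integer trace identity `a + d = k` reduces mod `n`
(plumbing shared by the instances). [folklore] -/
private theorem trace_ne_of_dvd_of_zmod {n M : ℕ} (hn : n ∣ M)
    (hz : ∀ a d : ZMod n, a * d = 1 → a + d ≠ 0 ∧ a + d ≠ 1 ∧ a + d ≠ -1)
    {γ : SL(2, ℤ)} (hγ : γ ∈ Gamma0 M) :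
    γ 0 0 + γ 1 1 ≠ 0 ∧ γ 0 0 + γ 1 1 ≠ 1 ∧ γ 0 0 + γ 1 1 ≠ -1 := by
  have hc : (n : ℤ) ∣ γ 1 0 := by
    rw [Gamma0_mem] at hγ
    exact dvd_trans (by exact_mod_cast hn) ((ZMod.intCast_zmod_eq_zero_iff_dvd _ _).mp hγ)
  have hdet : γ 0 0 * γ 1 1 - γ 0 1 * γ 1 0 = 1 := by
    have := Matrix.det_fin_two (γ : Matrix (Fin 2) (Fin 2) ℤ)
    rw [γ.det_coe] at this
    exact this.symm
  have hmod : ((γ 0 0 : ℤ) : ZMod n) * ((γ 1 1 : ℤ) : ZMod n) = 1 := by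
    have hc0 : ((γ 1 0 : ℤ) : ZMod n) = 0 := (ZMod.intCast_zmod_eq_zero_iff_dvd _ n).mpr hc
    have := congrArg (Int.cast : ℤ → ZMod n) hdet
    push_cast at this
    rw [hc0, mul_zero, sub_zero] at this
    exact this
  obtain ⟨h0, h1, h2⟩ := hz _ _ hmod
  refine ⟨fun h => h0 ?_, fun h => h1 ?_, fun h => h2 ?_⟩
  · exact_mod_cast congrArg (Int.cast : ℤ → ZMod n) h
  · exact_mod_cast congrArg (Int.cast : ℤ → ZMod n) h
  · exact_mod_cast congrArg (Int.cast : ℤ → ZMod n) h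

/-- **No elliptic elements in `Γ₀(M)` for `4 ∣ M`** (`ε₂ = 0` as `4 ∣ M`, `ε₃ = 0` as `2 ∣ M`, `(−3/2) = −1`):
`a d ≡ 1 (mod 4)` forces `a + d ≡ 2 (mod 4)`. [cite: DiamondShurman2005, Cor. 3.7.2] -/
theorem trace_ne_of_four_dvd {M : ℕ} (h4 : 4 ∣ M) {γ : SL(2, ℤ)} (hγ : γ ∈ Gamma0 M) :
    γ 0 0 + γ 1 1 ≠ 0 ∧ γ 0 0 + γ 1 1 ≠ 1 ∧ γ 0 0 + γ 1 1 ≠ -1 :=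
  trace_ne_of_dvd_of_zmod h4 (fun _ _ h => zmod_four_trace h) hγ

/-- **No elliptic elements in `Γ₀(M)` for `6 ∣ M`** (`ε₂ = 0` as `3 ≡ 3 (mod 4)` divides `M`, `ε₃ = 0` as
`2 ≡ 2 (mod 3)` divides `M`): `a d ≡ 1 (mod 6)` forces `a + d ∈ {2, 4} (mod 6)`. [cite: DiamondShurman2005, Cor. 3.7.2] -/
theorem trace_ne_of_six_dvd {M : ℕ} (h6 : 6 ∣ M) {γ : SL(2, ℤ)} (hγ : γ ∈ Gamma0 M) :
    γ 0 0 + γ 1 1 ≠ 0 ∧ γ 0 0 + γ 1 1 ≠ 1 ∧ γ 0 0 + γ 1 1 ≠ -1 :=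
  trace_ne_of_dvd_of_zmod h6 (fun _ _ h => zmod_six_trace h) hγ

end Gamma0Free

open Gamma0Free in
/-- **Kulkarni's theorem for an elliptic-free `Γ₀(M)` (general form of the torsion-free case)**: if no element of
`Γ₀(M)` has trace `0` or `±1` (equivalently `ε₂(Γ₀(M)) = ε₃(Γ₀(M)) = 0`: the finite-index subgroup `Γ₀(M)/{±1}` of
`PSL₂(ℤ) = ℤ/2 ∗ ℤ/3` meets no conjugate of a factor), then `Γ₀(M) = {±1} × e(F)` with `F` free and the decomposition
`γ = ± e(w)` unique — the free generators being Kulkarni's independent side pairings, none of finite order.  Proof as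
in §4 with `trace_ne_of_nine_dvd` replaced by the hypothesis. [cite: Kulkarni1991, Thm. 3.2 and Thm. 3.3] -/
theorem gamma0_eq_negOne_prod_free_of_trace_ne (M : ℕ)
    (htr : ∀ γ : SL(2, ℤ), γ ∈ Gamma0 M → γ 0 0 + γ 1 1 ≠ 0 ∧ γ 0 0 + γ 1 1 ≠ 1 ∧ γ 0 0 + γ 1 1 ≠ -1) :
    ∃ (ι : Type) (e : FreeGroup ι →* SL(2, ℤ)),
      (∀ w : FreeGroup ι, e w ∈ Gamma0 M) ∧
      ∀ γ : SL(2, ℤ), γ ∈ Gamma0 M →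
        ∃! p : FreeGroup ι × Bool, γ = (if p.2 then (-1 : SL(2, ℤ)) else 1) * e p.1 := by
  haveI : Nonempty Bool := ⟨true⟩
  let φ : ∀ b : Bool, PUnit.{1} →* Fac b := fun _ => 1
  let proj : SL(2, ℤ) →* PushoutI φ := (PushoutI.ofCoprodI (φ := φ)).comp fromSL
  let K : Subgroup (PushoutI φ) := (Gamma0 M).map proj
  haveI hK : IsFreeGroup K :=
    isFreeGroup_of_finite_factors (trivMaps_injective φ) K fun k hk hfin =>
      proj_eq_one_of_isOfFinOrder_of_trace_ne φ htr hk hfin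
  let πK : Gamma0 M →* K := (proj.comp (Gamma0 M).subtype).codRestrict K fun γ => ⟨γ, γ.2, rfl⟩
  have hπK : ∀ γ : Gamma0 M, ((πK γ : K) : PushoutI φ) = proj (γ : SL(2, ℤ)) := fun γ => rfl
  have hπK_surj : Function.Surjective πK := by
    rintro ⟨_, γ, hγ, rfl⟩
    exact ⟨⟨γ, hγ⟩, rfl⟩
  choose sec hsec using fun x : IsFreeGroup.Generators K => hπK_surj (IsFreeGroup.of x)
  let e₀ : FreeGroup (IsFreeGroup.Generators K) →* Gamma0 M := FreeGroup.lift sec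
  let e : FreeGroup (IsFreeGroup.Generators K) →* SL(2, ℤ) := (Gamma0 M).subtype.comp e₀
  have he : ∀ w, e w = ((e₀ w : Gamma0 M) : SL(2, ℤ)) := fun w => rfl
  have hcomp : πK.comp e₀ = (IsFreeGroup.mulEquiv K).toMonoidHom := by
    refine FreeGroup.ext_hom _ _ fun x => ?_
    rw [MonoidHom.comp_apply, MulEquiv.coe_toMonoidHom]
    show πK (FreeGroup.lift sec (FreeGroup.of x)) = _
    rw [FreeGroup.lift_apply_of, hsec]
    rfl
  have hcomp' : ∀ w, πK (e₀ w) = IsFreeGroup.mulEquiv K w := fun w => by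
    rw [← MonoidHom.comp_apply, hcomp]; rfl
  refine ⟨IsFreeGroup.Generators K, e, fun w => (e₀ w).2, fun γ hγ => ?_⟩
  let w := (IsFreeGroup.mulEquiv K).symm (πK ⟨γ, hγ⟩)
  have hw : proj (e w) = proj γ := by
    rw [he, ← hπK, hcomp', MulEquiv.apply_symm_apply]
    exact hπK ⟨γ, hγ⟩
  have h1 : proj (γ * (e w)⁻¹) = 1 := by rw [map_mul, map_inv, hw, mul_inv_cancel]
  have hex : ∃ s : Bool, γ = (if s then (-1 : SL(2, ℤ)) else 1) * e w := by
    rcases eq_one_or_eq_neg_one_of_proj_eq_one φ h1 with h | h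
    · exact ⟨false, by rw [mul_inv_eq_one] at h; simpa using h⟩
    · exact ⟨true, by rw [mul_inv_eq_iff_eq_mul] at h; simpa using h⟩
  obtain ⟨s, hs⟩ := hex
  refine ⟨(w, s), hs, ?_⟩
  rintro ⟨w', s'⟩ hs'
  have hww : w' = w := by
    have h2 : proj (e w') = proj (e w) := by
      have a1 := congrArg proj hs
      have a2 := congrArg proj hs'
      rw [map_mul] at a1 a2
      have hsgn : ∀ b : Bool, proj (if b then (-1 : SL(2, ℤ)) else 1) = 1 := by
        intro b; cases b
        · simp
        · simp only [if_true]; exact proj_neg_one φ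
      rw [hsgn, one_mul] at a1 a2
      rw [← a2, ← a1]
    have h3 : πK (e₀ w') = πK (e₀ w) := Subtype.ext (by rw [hπK, hπK, ← he, ← he, h2])
    rw [hcomp', hcomp'] at h3
    exact (IsFreeGroup.mulEquiv K).injective h3
  subst hww
  have hss : (if s' then (-1 : SL(2, ℤ)) else 1) = (if s then (-1 : SL(2, ℤ)) else 1) :=
    mul_right_cancel (hs'.symm.trans hs)
  have : s' = s := by
    cases s <;> cases s'
    · rfl
    · exfalso
      rw [if_pos rfl, if_neg Bool.false_ne_true] at hss
      exact neg_one_ne_one hss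
    · exfalso
      rw [if_pos rfl, if_neg Bool.false_ne_true] at hss
      exact neg_one_ne_one hss.symm
    · rfl
  rw [this]

open Gamma0Free in
/-- **`Γ₀(M) = {±1} × free` for `4 ∣ M`** — the `p = 2` twin of E-es-108 (no elliptic points: `ε₂ = 0` as `4 ∣ M`,
`ε₃ = 0` as `2 ∣ M`; Kulkarni's generators are then free). [cite: Kulkarni1991, Thm. 3.2 and Thm. 3.3]
[cite: DiamondShurman2005, Cor. 3.7.2] -/
theorem gamma0_eq_negOne_prod_free_of_four_dvd (M : ℕ) (h4 : 4 ∣ M) :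
    ∃ (ι : Type) (e : FreeGroup ι →* SL(2, ℤ)),
      (∀ w : FreeGroup ι, e w ∈ Gamma0 M) ∧
      ∀ γ : SL(2, ℤ), γ ∈ Gamma0 M →
        ∃! p : FreeGroup ι × Bool, γ = (if p.2 then (-1 : SL(2, ℤ)) else 1) * e p.1 :=
  gamma0_eq_negOne_prod_free_of_trace_ne M fun _ hγ => trace_ne_of_four_dvd h4 hγ

open Gamma0Free in
/-- **`Γ₀(M) = {±1} × free` for `6 ∣ M`** (no elliptic points: `ε₂ = 0` as `3 ∣ M`, `ε₃ = 0` as `2 ∣ M`).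
[cite: Kulkarni1991, Thm. 3.2 and Thm. 3.3] [cite: DiamondShurman2005, Cor. 3.7.2] -/
theorem gamma0_eq_negOne_prod_free_of_six_dvd (M : ℕ) (h6 : 6 ∣ M) :
    ∃ (ι : Type) (e : FreeGroup ι →* SL(2, ℤ)),
      (∀ w : FreeGroup ι, e w ∈ Gamma0 M) ∧
      ∀ γ : SL(2, ℤ), γ ∈ Gamma0 M →
        ∃! p : FreeGroup ι × Bool, γ = (if p.2 then (-1 : SL(2, ℤ)) else 1) * e p.1 :=
  gamma0_eq_negOne_prod_free_of_trace_ne M fun _ hγ => trace_ne_of_six_dvd h6 hγ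

end Literature.NumberTheory.ModularForms

end
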